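import Summits.CriticalPhenomena.SAWScalingLimit.Theorems.SAWCompassLatticeCompassSLEYbPolylineSimple
import Summits.CriticalPhenomena.SAWScalingLimit.Theorems.SAWCompassLatticeCompassSLEYbTightOfTraversalBound
import Literature.Probability.RandomPlanarGeometry.FreelyJointedSAWCovariance

/-!
# Glazman–Manolescu's `π/2` Yang–Baxter walks are drawn as SIMPLE curves (lattice input of stub I2b
# of crux `CompassSLE`, stmt-CriticalPhenomena-6965, line `registered` = `birth`, lead c6; file 2/3)

* Square tiling `Θ ≡ π/2`: side midpoints (`planeMidpoint_side_eq`), injectivity of the midpoint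
  map (`planeMidpoint_injective`); an arc (segment between the midpoints of two sides of a unit
  square) lies in its closed square and meets its boundary only at its ends
  (`mem_closedSquare_of_mem_segment`, `mem_openSquare_of_mem_segment`); distinct closed squares
  overlap only on boundaries (`face_eq_of_mem_openSquare_of_mem_closedSquare`), so arcs of
  different squares meet only at common ends (`mem_ends_of_mem_segment_of_ne`); the two
  non-crossing arcs of one square are disjoint (`disjoint_segment_of_sameFace`, GM Fig. 1).
* Walks: `pairwise_arcs` (the arcs of a `YBWalk` are drawn disjointly: `nodup`, `isChain`,
  `noncross`), `mk_polyline_map_planeMidpoint_mem_simple`, **`curve_mem_simple`** (for `a ≠ b`,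
  `δ ≠ 0`, `γ.curve (π/2) δ ∈ CurveClass.simple` for EVERY walk) and the registered piece
  `stub_ybCurveSimple` of the skeleton.

Reference: A. Glazman, I. Manolescu, Ann. Inst. Henri Poincaré Probab. Stat. 56 (2020), §1 and
Fig. 1 [GlazmanManolescu2019]. No named fact is used.
-/

noncomputable section

namespace Summit.CriticalPhenomena.SAWScalingLimit.Theorems.SAWCompassLatticeCompassSLE

open MeasureTheory Filter Topology Set Metric
open scoped NNReal ENNReal unitInterval
open Literature.Probability.RandomPlanarGeometry
open Literature.Probability.LatticeModels (polyline polylineFrom mem_range_polyline)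

namespace LatticeSimple

open Literature.Probability.RandomPlanarGeometry.SAW.YangBaxter
open TightOfTraversalBound (planeMidpoint_vert planeMidpoint_slant exists_eq_side_of_eq_faces)

/-! ### The square tiling `Θ ≡ π/2`: arcs are drawn disjointly -/

/-- **The midpoints of the four sides of the unit square `(k, j)`**, relative to its centre
`(k + 1/2) + j i`: West `-1/2`, East `+1/2`, South `-i/2`, North `+i/2`. [folklore] -/
theorem planeMidpoint_side_eq (k j : ℤ) (sd : Side) :
    planeMidpoint (fun (_ : ℤ) => Real.pi / 2) (Face.side (k, j) sd) =
      ((k : ℂ) + 1 / 2 + (j : ℂ) * Complex.I) +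
        (match sd with
          | .W => -(1 / 2 : ℂ) | .E => (1 / 2 : ℂ) | .S => -(1 / 2 : ℂ) * Complex.I | .N => (1 / 2 : ℂ) * Complex.I) := by
  cases sd with
  | W => simp only [Face.side, planeMidpoint_vert]; ring
  | E => simp only [Face.side, planeMidpoint_vert]; push_cast; ring
  | S => simp only [Face.side, planeMidpoint_slant]; ring
  | N => simp only [Face.side, planeMidpoint_slant]; push_cast; ring

/-- Real coordinates of the side midpoints of the unit square `(k, j)`. [folklore] -/
theorem re_im_planeMidpoint_side (k j : ℤ) (sd : Side) :
    (planeMidpoint (fun (_ : ℤ) => Real.pi / 2) (Face.side (k, j) sd)).re =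
        (k : ℝ) + 1 / 2 + (match sd with | .W => -(1 / 2 : ℝ) | .E => 1 / 2 | .S => 0 | .N => 0) ∧
      (planeMidpoint (fun (_ : ℤ) => Real.pi / 2) (Face.side (k, j) sd)).im =
        (j : ℝ) + (match sd with | .W => (0 : ℝ) | .E => 0 | .S => -(1 / 2) | .N => 1 / 2) := by
  rw [planeMidpoint_side_eq]
  cases sd <;> constructor <;> simp

/-- **The midpoint map of the square tiling is injective**: midpoints of vertical edges have
integer coordinates `(k, j)`, those of horizontal edges half-integer ones `(k + 1/2, j - 1/2)`.
[folklore] -/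
theorem planeMidpoint_injective : Function.Injective (planeMidpoint (fun (_ : ℤ) => Real.pi / 2)) := by
  intro e e' h
  have hre := congrArg Complex.re h
  have him := congrArg Complex.im h
  cases e with
  | vert k j =>
    cases e' with
    | vert k' j' =>
      rw [planeMidpoint_vert, planeMidpoint_vert] at hre him
      simp at hre him
      rw [show k = k' by exact_mod_cast hre, show j = j' by exact_mod_cast him]
    | slant k' j' =>
      rw [planeMidpoint_vert, planeMidpoint_slant] at hre
      simp at hre
      have : (2 * k : ℤ) = 2 * k' + 1 := by exact_mod_cast (show (2 * k : ℝ) = 2 * k' + 1 by linarith)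
      omega
  | slant k j =>
    cases e' with
    | vert k' j' =>
      rw [planeMidpoint_vert, planeMidpoint_slant] at hre
      simp at hre
      have : (2 * k' : ℤ) = 2 * k + 1 := by exact_mod_cast (show (2 * k' : ℝ) = 2 * k + 1 by linarith)
      omega
    | slant k' j' =>
      rw [planeMidpoint_slant, planeMidpoint_slant] at hre him
      simp at hre him
      rw [show k = k' by exact_mod_cast hre, show j = j' by exact_mod_cast him]

/-- **An arc lies in its closed unit square**: every point of the segment joining the midpoints
of two sides of the square `(k, j)` has abscissa in `[k, k+1]` and ordinate in `[j-1/2, j+1/2]`.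
[folklore] -/
theorem mem_closedSquare_of_mem_segment (k j : ℤ) (sd td : Side) {z : ℂ}
    (hz : z ∈ segment ℝ (planeMidpoint (fun (_ : ℤ) => Real.pi / 2) (Face.side (k, j) sd)) (planeMidpoint (fun (_ : ℤ) => Real.pi / 2) (Face.side (k, j) td))) :
    (k : ℝ) ≤ z.re ∧ z.re ≤ k + 1 ∧ (j : ℝ) - 1 / 2 ≤ z.im ∧ z.im ≤ j + 1 / 2 := by
  rw [segment_eq_image'] at hz
  obtain ⟨θ, ⟨hθ0, hθ1⟩, rfl⟩ := hz
  obtain ⟨hre1, him1⟩ := re_im_planeMidpoint_side k j sd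
  obtain ⟨hre2, him2⟩ := re_im_planeMidpoint_side k j td
  simp only [Complex.add_re, Complex.add_im, Complex.real_smul, Complex.re_ofReal_mul,
    Complex.im_ofReal_mul, Complex.sub_re, Complex.sub_im, hre1, him1, hre2, him2]
  cases sd <;> cases td <;> simp only [] <;> refine ⟨?_, ?_, ?_, ?_⟩ <;> nlinarith

/-- **An arc between two DIFFERENT sides meets the boundary of its square only at its ends**:
every other point of the segment has abscissa in `(k, k+1)` and ordinate in `(j-1/2, j+1/2)`.
[folklore] -/
theorem mem_openSquare_of_mem_segment (k j : ℤ) {sd td : Side} (hst : sd ≠ td) {z : ℂ}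
    (hz : z ∈ segment ℝ (planeMidpoint (fun (_ : ℤ) => Real.pi / 2) (Face.side (k, j) sd)) (planeMidpoint (fun (_ : ℤ) => Real.pi / 2) (Face.side (k, j) td)))
    (h1 : z ≠ planeMidpoint (fun (_ : ℤ) => Real.pi / 2) (Face.side (k, j) sd)) (h2 : z ≠ planeMidpoint (fun (_ : ℤ) => Real.pi / 2) (Face.side (k, j) td)) :
    (k : ℝ) < z.re ∧ z.re < k + 1 ∧ (j : ℝ) - 1 / 2 < z.im ∧ z.im < j + 1 / 2 := by
  rw [segment_eq_image'] at hz
  obtain ⟨θ, ⟨hθ0, hθ1⟩, rfl⟩ := hz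
  have hθ0' : 0 < θ := by
    rcases hθ0.lt_or_eq with h | h
    · exact h
    · exact absurd (by rw [← h]; simp) h1
  have hθ1' : θ < 1 := by
    rcases hθ1.lt_or_eq with h | h
    · exact h
    · exact absurd (by rw [h]; simp) h2
  obtain ⟨hre1, him1⟩ := re_im_planeMidpoint_side k j sd
  obtain ⟨hre2, him2⟩ := re_im_planeMidpoint_side k j td
  simp only [Complex.add_re, Complex.add_im, Complex.real_smul, Complex.re_ofReal_mul,
    Complex.im_ofReal_mul, Complex.sub_re, Complex.sub_im, hre1, him1, hre2, him2]
  cases sd <;> cases td <;> simp only [] <;> first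
    | exact absurd rfl hst
    | (refine ⟨?_, ?_, ?_, ?_⟩ <;> nlinarith)

/-- **Two unit squares of the tiling whose closed cells share a point interior to one of them
coincide.** [folklore] -/
theorem face_eq_of_mem_openSquare_of_mem_closedSquare {k j k' j' : ℤ} {x y : ℝ}
    (h1 : (k : ℝ) < x ∧ x < k + 1 ∧ (j : ℝ) - 1 / 2 < y ∧ y < j + 1 / 2)
    (h2 : (k' : ℝ) ≤ x ∧ x ≤ k' + 1 ∧ (j' : ℝ) - 1 / 2 ≤ y ∧ y ≤ j' + 1 / 2) :
    ((k, j) : Face) = (k', j') := by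
  obtain ⟨a1, a2, a3, a4⟩ := h1
  obtain ⟨b1, b2, b3, b4⟩ := h2
  have hk1 : k < k' + 1 := by exact_mod_cast (show (k : ℝ) < k' + 1 by linarith)
  have hk2 : k' < k + 1 := by exact_mod_cast (show (k' : ℝ) < k + 1 by linarith)
  have hj1 : j < j' + 1 := by exact_mod_cast (show (j : ℝ) < j' + 1 by linarith)
  have hj2 : j' < j + 1 := by exact_mod_cast (show (j' : ℝ) < j + 1 by linarith)
  rw [show k = k' by omega, show j = j' by omega]

/-- **Arcs of different squares meet only at common ends.** If `sd ≠ td` are sides of the square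
`f`, `sd' ≠ td'` sides of a different square `f'`, then a common point of the two arcs (segments
between the side midpoints) is an end of the first AND an end of the second. [folklore] -/
theorem mem_ends_of_mem_segment_of_ne {f f' : Face} (hff' : f ≠ f') {sd td sd' td' : Side}
    (hst : sd ≠ td) (hst' : sd' ≠ td') {z : ℂ}
    (hz : z ∈ segment ℝ (planeMidpoint (fun (_ : ℤ) => Real.pi / 2) (f.side sd)) (planeMidpoint (fun (_ : ℤ) => Real.pi / 2) (f.side td)))
    (hz' : z ∈ segment ℝ (planeMidpoint (fun (_ : ℤ) => Real.pi / 2) (f'.side sd')) (planeMidpoint (fun (_ : ℤ) => Real.pi / 2) (f'.side td'))) :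
    (z = planeMidpoint (fun (_ : ℤ) => Real.pi / 2) (f.side sd) ∨ z = planeMidpoint (fun (_ : ℤ) => Real.pi / 2) (f.side td)) ∧
      (z = planeMidpoint (fun (_ : ℤ) => Real.pi / 2) (f'.side sd') ∨ z = planeMidpoint (fun (_ : ℤ) => Real.pi / 2) (f'.side td')) := by
  obtain ⟨k, j⟩ := f
  obtain ⟨k', j'⟩ := f'
  constructor
  · by_contra h
    rw [not_or] at h
    have ho := mem_openSquare_of_mem_segment k j hst hz h.1 h.2
    have hc := mem_closedSquare_of_mem_segment k' j' sd' td' hz'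
    exact hff' (face_eq_of_mem_openSquare_of_mem_closedSquare ho hc)
  · by_contra h
    rw [not_or] at h
    have ho := mem_openSquare_of_mem_segment k' j' hst' hz' h.1 h.2
    have hc := mem_closedSquare_of_mem_segment k j sd td hz
    exact hff'.symm (face_eq_of_mem_openSquare_of_mem_closedSquare ho hc)

/-- **Two non-crossing arcs of the same square with four distinct end-sides are disjoint**: if the
sides `s₁, s₂, s₃, s₄` are pairwise distinct and `{s₁, s₂}` is not a straight (opposite) pair,
the segments `[m s₁, m s₂]` and `[m s₃, m s₄]` do not meet (they are the two parallel corner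
arcs of Fig. 1 of Glazman–Manolescu). [cite: GlazmanManolescu2019, §1, Fig. 1] -/
theorem disjoint_segment_of_sameFace (f : Face) {s₁ s₂ s₃ s₄ : Side}
    (h12 : s₁ ≠ s₂) (h13 : s₁ ≠ s₃) (h14 : s₁ ≠ s₄) (h23 : s₂ ≠ s₃) (h24 : s₂ ≠ s₄)
    (h34 : s₃ ≠ s₄) (hkind : arcKind s₁ s₂ ≠ .straight) {z : ℂ}
    (hz : z ∈ segment ℝ (planeMidpoint (fun (_ : ℤ) => Real.pi / 2) (f.side s₁)) (planeMidpoint (fun (_ : ℤ) => Real.pi / 2) (f.side s₂)))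
    (hz' : z ∈ segment ℝ (planeMidpoint (fun (_ : ℤ) => Real.pi / 2) (f.side s₃)) (planeMidpoint (fun (_ : ℤ) => Real.pi / 2) (f.side s₄))) : False := by
  obtain ⟨k, j⟩ := f
  rw [segment_eq_image'] at hz hz'
  obtain ⟨θ, ⟨hθ0, hθ1⟩, rfl⟩ := hz
  obtain ⟨θ', ⟨hθ0', hθ1'⟩, hzz⟩ := hz'
  have hre := congrArg Complex.re hzz
  have him := congrArg Complex.im hzz
  obtain ⟨hre1, him1⟩ := re_im_planeMidpoint_side k j s₁
  obtain ⟨hre2, him2⟩ := re_im_planeMidpoint_side k j s₂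
  obtain ⟨hre3, him3⟩ := re_im_planeMidpoint_side k j s₃
  obtain ⟨hre4, him4⟩ := re_im_planeMidpoint_side k j s₄
  simp only [Complex.add_re, Complex.add_im, Complex.real_smul, Complex.re_ofReal_mul,
    Complex.im_ofReal_mul, Complex.sub_re, Complex.sub_im, hre1, him1, hre2, him2, hre3, him3,
    hre4, him4] at hre him
  cases s₁ <;> cases s₂ <;> cases s₃ <;> cases s₄ <;> simp only [] at hre him <;> first
    | exact absurd rfl h12 | exact absurd rfl h13 | exact absurd rfl h14 | exact absurd rfl h23
    | exact absurd rfl h24 | exact absurd rfl h34 | exact absurd rfl hkind | nlinarith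

/-! ### The arcs of a walk; simplicity of the drawn walk -/

variable {D : Set Face} {a b : MidEdge}

/-- The two ends of an arc drawn in the face `f` are two sides of `f`. [folklore] -/
theorem exists_sides_of_arcFace {p : MidEdge × MidEdge} {f : Face} (h : arcFace p = some f) :
    ∃ sd td : Side, p.1 = f.side sd ∧ p.2 = f.side td := by
  obtain ⟨h1, h2⟩ := eq_faces_of_commonFace h
  obtain ⟨sd, hsd⟩ := exists_eq_side_of_eq_faces h1
  obtain ⟨td, htd⟩ := exists_eq_side_of_eq_faces h2
  exact ⟨sd, td, hsd, htd⟩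

/-- **Which pairs of arcs in one square cross**: among four pairwise distinct sides, if the first
two form a straight (opposite) pair then the two arcs are the crossing pattern `{W,E} + {S,N}`
excluded by `YBWalk.noncross`. [cite: GlazmanManolescu2019, §1, Fig. 1] -/
theorem straight_pattern :
    ∀ s₁ s₂ s₃ s₄ : Side, s₁ ≠ s₃ → s₁ ≠ s₄ → s₂ ≠ s₃ → s₂ ≠ s₄ → s₃ ≠ s₄ →
      arcKind s₁ s₂ = .straight →
      ((s₁ = .W ∧ s₂ = .E ∨ s₁ = .E ∧ s₂ = .W) ∧ (s₃ = .S ∧ s₄ = .N ∨ s₃ = .N ∧ s₄ = .S)) ∨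
        ((s₁ = .S ∧ s₂ = .N ∨ s₁ = .N ∧ s₂ = .S) ∧ (s₃ = .W ∧ s₄ = .E ∨ s₃ = .E ∧ s₄ = .W)) := by
  intro s₁ s₂ s₃ s₄
  cases s₁ <;> cases s₂ <;> cases s₃ <;> cases s₄ <;> decide

/-- The arcs of a walk, by index: `arcs[i] = (mids[i], mids[i+1])`. [folklore] -/
theorem length_arcs_add_one (γ : YBWalk D a b) : γ.arcs.length + 1 = γ.mids.length := by
  have h0 : 0 < γ.mids.length := List.length_pos_of_ne_nil γ.mids_ne_nil
  simp only [YBWalk.arcs, arcsOf, List.length_zip, List.length_tail]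
  omega

/-- The arcs of a walk, by index: `arcs[i] = (mids[i], mids[i+1])`. [folklore] -/
theorem getElem_arcs (γ : YBWalk D a b) (i : ℕ) (hi : i < γ.arcs.length) :
    γ.arcs[i] = (γ.mids[i]'(by have := length_arcs_add_one γ; omega),
      γ.mids[i + 1]'(by have := length_arcs_add_one γ; omega)) := by
  simp [YBWalk.arcs, arcsOf, List.getElem_zip]

/-- **The arcs of a Glazman–Manolescu walk on the square tiling are drawn disjointly**: the segments
of an earlier and a later arc meet at most in "end of the earlier = start of the later". Different
squares: closed unit squares overlap only on boundaries, which arcs touch only at their ends, and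
mid-edges are not repeated (`nodup`); same square: the two arcs are the non-crossing parallel corner
arcs (`noncross`, `isChain`). [cite: GlazmanManolescu2019, §1 and Fig. 1] -/
theorem pairwise_arcs (γ : YBWalk D a b) :
    γ.arcs.Pairwise (fun p q =>
      segment ℝ (planeMidpoint (fun (_ : ℤ) => Real.pi / 2) p.1) (planeMidpoint (fun (_ : ℤ) => Real.pi / 2) p.2) ∩
        segment ℝ (planeMidpoint (fun (_ : ℤ) => Real.pi / 2) q.1) (planeMidpoint (fun (_ : ℤ) => Real.pi / 2) q.2) ⊆
      {planeMidpoint (fun (_ : ℤ) => Real.pi / 2) p.2} ∩ {planeMidpoint (fun (_ : ℤ) => Real.pi / 2) q.1}) := by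
  classical
  rw [List.pairwise_iff_getElem]
  intro i j hi hj hij
  have hlen := length_arcs_add_one γ
  have hpi := getElem_arcs γ i hi
  have hpj := getElem_arcs γ j hj
  have hnd := γ.nodup
  have hidx : ∀ {x y : ℕ} (hx : x < γ.mids.length) (hy : y < γ.mids.length),
      γ.mids[x] = γ.mids[y] → x = y := fun hx hy h => (hnd.getElem_inj_iff).1 h
  -- faces and sides of the two arcs
  obtain ⟨f, -, hf⟩ := γ.arc_mem _ (List.getElem_mem hi)
  obtain ⟨f', -, hf'⟩ := γ.arc_mem _ (List.getElem_mem hj)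
  have hmem_i : γ.arcs[i] ∈ γ.arcs := List.getElem_mem hi
  have hmem_j : γ.arcs[j] ∈ γ.arcs := List.getElem_mem hj
  rw [hpi] at hf hmem_i ⊢
  rw [hpj] at hf' hmem_j ⊢
  obtain ⟨s₁, s₂, h1, h2⟩ := exists_sides_of_arcFace hf
  obtain ⟨s₃, s₄, h3, h4⟩ := exists_sides_of_arcFace hf'
  simp only at h1 h2 h3 h4
  have hs12 : s₁ ≠ s₂ := fun h => by
    have := hidx (by omega) (by omega) (h1.trans (h ▸ h2.symm)); omega
  have hs34 : s₃ ≠ s₄ := fun h => by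
    have := hidx (by omega) (by omega) (h3.trans (h ▸ h4.symm)); omega
  intro z hz
  simp only [Set.mem_inter_iff] at hz
  obtain ⟨hzi, hzj⟩ := hz
  rw [h1, h2] at hzi
  rw [h3, h4] at hzj
  simp only [Set.mem_inter_iff, Set.mem_singleton_iff]
  rw [h2, h3]
  by_cases hff' : f = f'
  · subst hff'
    exfalso
    -- same square: the two arcs are not consecutive, so their four end mid-edges are distinct
    have hj2 : i + 1 ≠ j := by
      intro hij1
      subst hij1
      have hch := (List.isChain_iff_getElem.1 γ.isChain) i (by omega)
      rw [hpi, hpj, hf, hf'] at hch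
      exact hch rfl
    have h13 : s₁ ≠ s₃ := fun h => by
      have := hidx (by omega) (by omega) (h1.trans (h ▸ h3.symm)); omega
    have h14 : s₁ ≠ s₄ := fun h => by
      have := hidx (by omega) (by omega) (h1.trans (h ▸ h4.symm)); omega
    have h23 : s₂ ≠ s₃ := fun h => by
      have := hidx (by omega) (by omega) (h2.trans (h ▸ h3.symm)); omega
    have h24 : s₂ ≠ s₄ := fun h => by
      have := hidx (by omega) (by omega) (h2.trans (h ▸ h4.symm)); omega
    rw [h1, h2] at hmem_i
    rw [h3, h4] at hmem_j
    -- the straight (crossing) pattern is excluded by `noncross`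
    have hkind : arcKind s₁ s₂ ≠ .straight := by
      intro hk
      have hnc := γ.noncross f
      rcases straight_pattern s₁ s₂ s₃ s₄ h13 h14 h23 h24 hs34 hk with
        ⟨⟨rfl, rfl⟩ | ⟨rfl, rfl⟩, ⟨rfl, rfl⟩ | ⟨rfl, rfl⟩⟩ |
        ⟨⟨rfl, rfl⟩ | ⟨rfl, rfl⟩, ⟨rfl, rfl⟩ | ⟨rfl, rfl⟩⟩
      · exact hnc (Or.inl hmem_i) (Or.inl hmem_j)
      · exact hnc (Or.inl hmem_i) (Or.inr hmem_j)
      · exact hnc (Or.inr hmem_i) (Or.inl hmem_j)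
      · exact hnc (Or.inr hmem_i) (Or.inr hmem_j)
      · exact hnc (Or.inl hmem_j) (Or.inl hmem_i)
      · exact hnc (Or.inr hmem_j) (Or.inl hmem_i)
      · exact hnc (Or.inl hmem_j) (Or.inr hmem_i)
      · exact hnc (Or.inr hmem_j) (Or.inr hmem_i)
    exact disjoint_segment_of_sameFace f hs12 h13 h14 h23 h24 hs34 hkind hzi hzj
  · -- different squares: a common point is an end of both arcs
    obtain ⟨hzA, hzB⟩ := mem_ends_of_mem_segment_of_ne hff' hs12 hs34 hzi hzj
    rw [← h1, ← h2] at hzA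
    rw [← h3, ← h4] at hzB
    rw [← h2, ← h3]
    have hinj := planeMidpoint_injective
    rcases hzA with hzA | hzA <;> rcases hzB with hzB | hzB
    · have := hidx (by omega) (by omega) (hinj (hzA.symm.trans hzB)); omega
    · have := hidx (by omega) (by omega) (hinj (hzA.symm.trans hzB)); omega
    · exact ⟨hzA, hzB⟩
    · have := hidx (by omega) (by omega) (hinj (hzA.symm.trans hzB)); omega

/-- **A Glazman–Manolescu walk on the square tiling, drawn at mesh `1`, is a simple curve class**
(for `a ≠ b`; the trivial walk `a = b` is a constant curve). [cite: GlazmanManolescu2019, §1] -/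
theorem mk_polyline_map_planeMidpoint_mem_simple (γ : YBWalk D a b) (hab : a ≠ b) :
    CurveClass.mk ⟨polyline (γ.mids.map (planeMidpoint (fun (_ : ℤ) => Real.pi / 2)))⟩ ∈ (CurveClass.simple : Set (CurveClass ℂ)) := by
  obtain ⟨e₁, l, hm⟩ := exists_mids_eq_cons_cons γ hab
  have hinj := planeMidpoint_injective
  set m := planeMidpoint (fun (_ : ℤ) => Real.pi / 2) with hmdef
  have hmap : γ.mids.map m = m a :: m e₁ :: l.map m := by rw [hm]; rfl
  rw [hmap]
  refine mk_polyline_mem_simple_of_pairwise (m a) (m e₁) (l.map m) ?_ ?_ ?_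
  · -- consecutive vertices are distinct (all vertices are)
    have hnd : (γ.mids.map m).Nodup := γ.nodup.map hinj
    rw [hmap] at hnd
    exact hnd.isChain
  · -- the arcs are drawn disjointly
    have key := pairwise_arcs γ
    have hz : (m a :: m e₁ :: l.map m).zip (m e₁ :: l.map m) = γ.arcs.map (Prod.map m m) := by
      rw [← hmap, YBWalk.arcs, arcsOf, ← List.zip_map, List.map_tail, hmap]
      rfl
    rw [hz, List.pairwise_map]
    exact key
  · -- first vertex `m a` ≠ last vertex `m b`
    have hl := γ.getLast_eq
    rw [hm, List.getLast?_eq_some_getLast (List.cons_ne_nil _ _)] at hl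
    have hl' : (a :: e₁ :: l).getLast (List.cons_ne_nil _ _) = b := Option.some.inj hl
    have : (m a :: m e₁ :: l.map m).getLast (List.cons_ne_nil _ _) = m b := by
      rw [← hl']
      exact List.getLast_map (l := a :: e₁ :: l) (f := m) (by simp)
    rw [this]
    exact fun h => hab (hinj h)

/-- **Glazman–Manolescu walks on the square tiling are drawn as SIMPLE curves**: for `a ≠ b` and
`δ ≠ 0`, the rescaled polyline class `γ.curve (π/2) δ` of every walk from `a` to `b` (in any set
of faces) is a simple curve class (`CurveClass.simple`). This is the lattice input of stub I2b of
the `CompassSLE` skeleton (a.s. simplicity of subsequential limits).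
[cite: GlazmanManolescu2019, §1 ("a self-avoiding walk … is a simple curve")] -/
theorem curve_mem_simple (γ : YBWalk D a b) (hab : a ≠ b) {δ : ℝ} (hδ : δ ≠ 0) :
    γ.curve (fun (_ : ℤ) => Real.pi / 2) δ ∈ (CurveClass.simple : Set (CurveClass ℂ)) := by
  obtain ⟨e₁, l, hm⟩ := exists_mids_eq_cons_cons γ hab
  set m := planeMidpoint (fun (_ : ℤ) => Real.pi / 2) with hmdef
  -- the dilation `z ↦ δ z` as a real-affine map and as a continuous map
  set fa : ℂ →ᵃ[ℝ] ℂ := (LinearMap.mulLeft ℝ (δ : ℂ)).toAffineMap with hfa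
  set F : C(ℂ, ℂ) := ⟨fun z => (δ : ℂ) * z, by fun_prop⟩ with hF
  have hFinj : Function.Injective F := mul_right_injective₀ (Complex.ofReal_ne_zero.2 hδ)
  have hcurve : γ.curve (fun (_ : ℤ) => Real.pi / 2) δ = (CurveClass.mk ⟨polyline (γ.mids.map m)⟩).map F := by
    rw [CurveClass.map_mk]
    unfold YBWalk.curve YBWalk.path YBWalk.points
    congr 1
    ext t : 2
    show polyline (γ.mids.map fun e => (δ : ℂ) * m e) t = F (polyline (γ.mids.map m) t)
    have h1 : γ.mids.map (fun e => (δ : ℂ) * m e) = ((γ.mids.map m)).map fa := by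
      rw [List.map_map]
      refine List.map_congr_left fun e _ => ?_
      simp [hfa, LinearMap.mulLeft_apply]
    rw [h1, hm]
    show polyline ((m a :: (e₁ :: l).map m).map fa) t = F (polyline (m a :: (e₁ :: l).map m) t)
    rw [Polyline.polyline_map_apply fa]
    simp [hfa, hF, LinearMap.mulLeft_apply]
  rw [hcurve]
  exact FreelyJointedSAW.map_mem_simple hFinj (mk_polyline_map_planeMidpoint_mem_simple γ hab)

end LatticeSimple

open LatticeSimple Literature.Probability.RandomPlanarGeometry.SAW.YangBaxter in
/-- **Registered piece `stub_ybCurveSimple` of the `CompassSLE` skeleton (lattice half of stub I2b):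
Glazman–Manolescu walks on the square tiling are drawn as SIMPLE curve classes** (`a ≠ b`, `δ ≠ 0`,
any set of faces). [cite: GlazmanManolescu2019, §1] -/
theorem stub_ybCurveSimple :
    ∀ (D : Set Face) (a b : MidEdge) (γ : YBWalk D a b), a ≠ b → ∀ δ : ℝ, δ ≠ 0 →
      γ.curve (fun (_ : ℤ) => Real.pi / 2) δ ∈ (CurveClass.simple : Set (CurveClass ℂ)) :=
  fun _ _ _ γ hab _ hδ => curve_mem_simple γ hab hδ

end Summit.CriticalPhenomena.SAWScalingLimit.Theorems.SAWCompassLatticeCompassSLE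

end
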